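import Mathlib
import HarnessLib
import Summits.Ventures.LatticeQCDFlow.Exactness.U1MultiStepFTHMCErgodic
import Summits.Ventures.LatticeQCDFlow.Exactness.NCMCGeneralSpaceDoeblinPowerCLT
import Summits.Ventures.LatticeQCDFlow.Scoring.DoeblinPowerBatchMeansCLT
import Summits.Ventures.LatticeQCDFlow.Scoring.DoeblinPowerBatchMeansTauInt

/-!
# HMC in trivialized variables on `U(1)` lattice gauge fields (the flow samplers' FT-HMC, `nstep` leapfrog steps, reported through the map): its one-step Doeblin certificate, every event a finite `τ_int`, certified burn-in, the CLT and asymptotically exact batch-means error bars from EVERY start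

HONEST FRAMING: exact (Metropolis-corrected) sampling algorithms for lattice gauge theory;
figures of merit are autocorrelation/cost numbers at stated couplings and volumes; no
continuum-physics claim.

Venture `LatticeQCDFlow` (cell pub-lqcd), topic `Exactness`, FANOUT row 9 (eng-latcore, GEN-23; kernel family B
`latflow.fthmc` on the `U(1)` rung: HMC in trivialized variables `V = F⁻¹(U)` for the pulled-back action `S∘F − log J`,
`nstep` leapfrog steps, reported through `F` — the venture's subject, Lüscher's trivializing-map HMC, exact by the
Metropolis test).  NEW WORK of the cell over the tree, nothing cited as a fact, no number claimed: gen-17's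
`U1MultiStepFTHMCErgodic.lean` (`u1LeapfrogFTHMCN_invariant_gibbsLaw`, `u1LeapfrogFTHMCN_uniformlyErgodic` — TV
convergence, the constant inside the proof), `U1MultiStepLeapfrogHMCErgodic.lean` (`u1LeapfrogHMCN_minorised`),
`U1FTHMCErgodic.lean` (`abs_pulledBackAction_le`), `TransformedKernelConvergence.lean` (`conjKernel_minorised`),
`U1LeapfrogHMCErgodic.lean` (`isProbabilityMeasure_u1GibbsLaw`), rows 13 / 8 (`…_of_nHit` consequences).  Printed
counterparts NAMED ONLY: Lüscher 2010 (trivializing maps); Albergo–Kanwar–Shanahan 2019 / Foreman et al. 2021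
(flow-based and field-transformed HMC for `U(1)` / `SU(N)`); Meyn–Tweedie 1993; Flegal–Jones 2010; Madras–Sokal 1988.

## Content (finite link set `ι`; action `S` measurable with `|S| ≤ s`; `F` a measurable equivalence of `U(1)^ι` with
## certified Jacobian `0 < j₁ ≤ J ≤ j₂` (`HasJacobian Haar^{⊗ι} F J`); `n ≥ 1` leapfrog steps of size `ε > 0`,
## `κ > 0`, the increment `g` in trivialized variables measurable, `K`-Lipschitz, bounded by `b`, `4 K ε n² ≤ 3`;
## `K̃ = conjKernel (u1LeapfrogHMCN ε κ g (S∘F − log J) n) F` the REPORTED kernel; `π = u1GibbsLaw S = Z⁻¹e^{−S}·Haar^{⊗ι}`)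

* **`u1LeapfrogFTHMCN_certificate`** — `K̃` leaves `π` invariant and `ε' • (Haar^{⊗ι})F ≤ K̃(U, ·) = K̃^1(U, ·)` for
  EVERY `U`, `0 < ε' ≤ 1` (the push-forward of product Haar by `F`, a probability law).
* **`u1LeapfrogFTHMCN_tauInt_setACF_le`** (ONE `B`: `τ_int(1_A) ≤ 1/2 + B/(1 − π(A))` for EVERY event — a topological
  sector, say), **`u1LeapfrogFTHMCN_timeAverage_bias_le`** (burn-in `B/N'` from EVERY start),
  **`u1LeapfrogFTHMCN_timeAverage_clt`**, **`u1LeapfrogFTHMCN_batchMeans_tendstoInMeasure`**,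
  **`u1LeapfrogFTHMCN_batchMeans_coverage`** (`σ²_f > 0`), **`u1LeapfrogFTHMCN_tauInt_tendstoInMeasure`** (`Var_π f ≠ 0`).

NOT CLAIMED: longer trajectories; that the map `F` HELPS (the certificate is the plain HMC's, transported — the
point of a trivializing map is a BETTER constant, which no compactness argument sees; the MEASURED `τ_int` decides);
a Lipschitz constant for a particular flow member's pulled-back force; `SU(N)`; floating point.
-/

noncomputable section

namespace Summit.Ventures.LatticeQCDFlow.Exactness

open MeasureTheory ProbabilityTheory ProbabilityTheory.Kernel Set Function Filter Topology
open Literature.MathematicalPhysics.QuantumFieldTheory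
open Summit.Ventures.LatticeQCDFlow.Scoring (replicaSEsq tauInt autocov kop)
open scoped ENNReal NNReal

section FTHMC

variable {ι : Type*} [Fintype ι] {ε κ : ℝ} {g : (ι → Circle) → ι → ℝ} {b : ℝ} {n : ℕ} {K : ℝ≥0}
  {S : (ι → Circle) → ℝ} {s : ℝ} {F : (ι → Circle) ≃ᵐ (ι → Circle)} {J : (ι → Circle) → ℝ} {j₁ j₂ : ℝ}

/-- **THE ONE-STEP DOEBLIN CERTIFICATE OF THE REPORTED `U(1)` FT-HMC KERNEL** (short trajectories): `K̃` leaves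
`u1GibbsLaw S` invariant and dominates `ε' ·` the push-forward of product Haar by `F` (a probability law) from EVERY
configuration in ONE step, `0 < ε' ≤ 1`. -/
theorem u1LeapfrogFTHMCN_certificate (hε : 0 < ε) (hκ : 0 < κ) (hn : 1 ≤ n)
    (hg : Measurable g) (hgK : LipschitzWith K g) (hshort : 4 * (K : ℝ) * ε * (n : ℝ) ^ 2 ≤ 3)
    (hb0 : 0 ≤ b) (hb : ∀ u l, ‖g u l‖ ≤ b) (hS : Measurable S) (hs : ∀ u, |S u| ≤ s)
    (hj₁ : 0 < j₁) (hJ₁ : ∀ v, j₁ ≤ J v) (hJ₂ : ∀ v, J v ≤ j₂) (hJm : Measurable J)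
    (hF : HasJacobian (Measure.pi fun _ : ι => haarProbability Circle) F fun v => ENNReal.ofReal (J v)) :
    Kernel.Invariant (conjKernel (u1LeapfrogHMCN ε κ hg (fun v => S (F v) - Real.log (J v)) n) F) (u1GibbsLaw S) ∧
      IsProbabilityMeasure ((Measure.pi fun _ : ι => haarProbability Circle).map F) ∧
      ∃ ε' : ℝ≥0∞, 0 < ε' ∧ ε' ≤ 1 ∧ ∀ U : (ι → Circle),
        ε' • ((Measure.pi fun _ : ι => haarProbability Circle).map F) ≤ nHit (conjKernel (u1LeapfrogHMCN ε κ hg (fun v => S (F v) - Real.log (J v)) n) F) 1 U := by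
  haveI : Fact (0 < κ) := ⟨hκ⟩
  have hJ : ∀ v, 0 < J v := fun v => hj₁.trans_le (hJ₁ v)
  have hSt : Measurable fun v : ι → Circle => S (F v) - Real.log (J v) :=
    (hS.comp F.measurable).sub (Real.measurable_log.comp hJm)
  obtain ⟨δ, hδ0, hmin⟩ := u1LeapfrogHMCN_minorised hε hκ hn hg hgK hshort hb0 hb hSt
    (abs_pulledBackAction_le hs hj₁ hJ₁ hJ₂)
  have hmin' := fun x => conjKernel_minorised hmin F x
  haveI : Fact (Measurable fun z : (ι → Circle) × (ι → ℝ) =>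
      (S (F z.1) - Real.log (J z.1)) + u1Kinetic κ z.2) :=
    ⟨(hSt.comp measurable_fst).add ((measurable_u1Kinetic κ).comp measurable_snd)⟩
  haveI : IsMarkovKernel (u1LeapfrogHMCN ε κ hg (fun v => S (F v) - Real.log (J v)) n) := by
    unfold u1LeapfrogHMCN; infer_instance
  haveI hν : IsProbabilityMeasure ((Measure.pi fun _ : ι => haarProbability Circle).map F) := Measure.isProbabilityMeasure_map F.measurable.aemeasurable
  have hδ1 : δ ≤ 1 := by
    have h := Measure.le_iff'.1 (hmin' fun _ => 1) univ
    rwa [Measure.smul_apply, smul_eq_mul, measure_univ, measure_univ, mul_one] at h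
  refine ⟨u1LeapfrogFTHMCN_invariant_gibbsLaw hκ hg hJ hJm hF hS n, hν, δ, hδ0, hδ1, fun U => ?_⟩
  rw [GeneralNCMC.nHit_one]
  exact hmin' U

/-! ## Figures of merit: `τ_int` of every event, burn-in, CLT, batch means, coverage, `τ̂_int` -/

/-- **EVERY EVENT HAS A FINITE `τ_int` UNDER THE REPORTED `U(1)` FT-HMC — ONE CONSTANT FOR ALL EVENTS**: `B ≥ 0` with
`τ_int(1_A) ≤ 1/2 + B/(1 − π(A))` (scorers' `Scoring.tauInt`) for EVERY measurable `A` with `0 < π(A) < 1`. -/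
theorem u1LeapfrogFTHMCN_tauInt_setACF_le (hε : 0 < ε) (hκ : 0 < κ) (hn : 1 ≤ n)
    (hg : Measurable g) (hgK : LipschitzWith K g) (hshort : 4 * (K : ℝ) * ε * (n : ℝ) ^ 2 ≤ 3)
    (hb0 : 0 ≤ b) (hb : ∀ u l, ‖g u l‖ ≤ b) (hS : Measurable S) (hs : ∀ u, |S u| ≤ s)
    (hj₁ : 0 < j₁) (hJ₁ : ∀ v, j₁ ≤ J v) (hJ₂ : ∀ v, J v ≤ j₂) (hJm : Measurable J)
    (hF : HasJacobian (Measure.pi fun _ : ι => haarProbability Circle) F fun v => ENNReal.ofReal (J v))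
    [IsMarkovKernel (u1LeapfrogHMCN ε κ hg (fun v => S (F v) - Real.log (J v)) n)] :
    ∃ B : ℝ, 0 ≤ B ∧ ∀ A : Set (ι → Circle), MeasurableSet A →
      0 < (u1GibbsLaw S).real A → (u1GibbsLaw S).real A < 1 →
      tauInt (setACF (conjKernel (u1LeapfrogHMCN ε κ hg (fun v => S (F v) - Real.log (J v)) n) F) (u1GibbsLaw S) A) ≤ 1 / 2 + B / (1 - (u1GibbsLaw S).real A) := by
  haveI := isProbabilityMeasure_u1GibbsLaw (ι := ι) hs
  obtain ⟨hinv, hν, ε', hε0, hε1, hmin⟩ := u1LeapfrogFTHMCN_certificate hε hκ hn hg hgK hshort hb0 hb hS hs hj₁ hJ₁ hJ₂ hJm hF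
  have he0 : 0 < ε'.toReal := ENNReal.toReal_pos hε0.ne' (ne_top_of_le_ne_top ENNReal.one_ne_top hε1)
  have he1 : ε'.toReal ≤ 1 := ENNReal.toReal_le_of_le_ofReal zero_le_one (by simpa using hε1)
  refine ⟨1 / ε'.toReal - 1, ?_, fun A hA h0 h1 => ?_⟩
  · rw [sub_nonneg, le_div_iff₀ he0]; nlinarith
  · simpa using GeneralNCMC.tauInt_setACF_le_of_nHit (GeneralNCMC.minorised_setwise hmin) hε0 hε1
      Nat.one_pos hinv hA h0 h1

/-- **CERTIFIED BURN-IN OF THE REPORTED `U(1)` FT-HMC FROM EVERY START**: one `B ≥ 0` with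
`|E_{μ₀}[(1/N') Σ_{t<N'} q(U_t)] − ∫ q dπ| ≤ B/N'` for EVERY initial law, every `[0,1]`-valued measurable `q`, `N' ≥ 1`. -/
theorem u1LeapfrogFTHMCN_timeAverage_bias_le (hε : 0 < ε) (hκ : 0 < κ) (hn : 1 ≤ n)
    (hg : Measurable g) (hgK : LipschitzWith K g) (hshort : 4 * (K : ℝ) * ε * (n : ℝ) ^ 2 ≤ 3)
    (hb0 : 0 ≤ b) (hb : ∀ u l, ‖g u l‖ ≤ b) (hS : Measurable S) (hs : ∀ u, |S u| ≤ s)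
    (hj₁ : 0 < j₁) (hJ₁ : ∀ v, j₁ ≤ J v) (hJ₂ : ∀ v, J v ≤ j₂) (hJm : Measurable J)
    (hF : HasJacobian (Measure.pi fun _ : ι => haarProbability Circle) F fun v => ENNReal.ofReal (J v))
    [IsMarkovKernel (u1LeapfrogHMCN ε κ hg (fun v => S (F v) - Real.log (J v)) n)] :
    ∃ B : ℝ, 0 ≤ B ∧ ∀ (μ₀ : Measure (ι → Circle)) [IsProbabilityMeasure μ₀]
      (q : (ι → Circle) → ℝ), Measurable q → (∀ U, 0 ≤ q U) → (∀ U, q U ≤ 1) →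
      ∀ N' : ℕ, N' ≠ 0 →
      |∫ x, (∑ t ∈ Finset.range N', q (x t)) / N'
          ∂(Kernel.trajMeasure (X := fun _ : ℕ => ι → Circle) μ₀
              (fun t : ℕ => (conjKernel (u1LeapfrogHMCN ε κ hg (fun v => S (F v) - Real.log (J v)) n) F).comap
                (fun h : (i : ↥(Finset.Iic t)) → (ι → Circle) =>
                  h ⟨t, Finset.mem_Iic.2 le_rfl⟩) (measurable_pi_apply _)))
        - ∫ U, q U ∂(u1GibbsLaw S)| ≤ B / N' := by
  haveI := isProbabilityMeasure_u1GibbsLaw (ι := ι) hs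
  obtain ⟨hinv, hν, ε', hε0, hε1, hmin⟩ := u1LeapfrogFTHMCN_certificate hε hκ hn hg hgK hshort hb0 hb hS hs hj₁ hJ₁ hJ₂ hJm hF
  have he0 : 0 < ε'.toReal := ENNReal.toReal_pos hε0.ne' (ne_top_of_le_ne_top ENNReal.one_ne_top hε1)
  refine ⟨1 / ε'.toReal, by positivity, fun μ₀ _ q hq h0 h1 N' hN => ?_⟩
  calc _ ≤ ((1 : ℕ) : ℝ) / (ε'.toReal * N') :=
        GeneralNCMC.chain_timeAverage_bias_le_of_nHit (GeneralNCMC.minorised_setwise hmin) hε0 hε1 Nat.one_pos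
          hinv μ₀ hq h0 h1 hN
    _ = 1 / ε'.toReal / N' := by rw [Nat.cast_one, div_div]

/-- **THE CLT FOR TIME AVERAGES OF THE REPORTED `U(1)` FT-HMC, FROM EVERY INITIAL LAW** (`|f| ≤ C` measurable,
`Y ~ N(0, σ²_f)`): `(√N')⁻¹ Σ_{t<N'} (f(U_t) − π f) ⇒ Y` under `P_{μ₀}`. -/
theorem u1LeapfrogFTHMCN_timeAverage_clt (hε : 0 < ε) (hκ : 0 < κ) (hn : 1 ≤ n)
    (hg : Measurable g) (hgK : LipschitzWith K g) (hshort : 4 * (K : ℝ) * ε * (n : ℝ) ^ 2 ≤ 3)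
    (hb0 : 0 ≤ b) (hb : ∀ u l, ‖g u l‖ ≤ b) (hS : Measurable S) (hs : ∀ u, |S u| ≤ s)
    (hj₁ : 0 < j₁) (hJ₁ : ∀ v, j₁ ≤ J v) (hJ₂ : ∀ v, J v ≤ j₂) (hJm : Measurable J)
    (hF : HasJacobian (Measure.pi fun _ : ι => haarProbability Circle) F fun v => ENNReal.ofReal (J v))
    [IsMarkovKernel (u1LeapfrogHMCN ε κ hg (fun v => S (F v) - Real.log (J v)) n)]
    {f : (ι → Circle) → ℝ} (hf : Measurable f) {C : ℝ} (hC : ∀ U, |f U| ≤ C)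
    (μ₀ : Measure (ι → Circle)) [IsProbabilityMeasure μ₀]
    [IsProbabilityMeasure (Kernel.trajMeasure (X := fun _ : ℕ => ι → Circle) μ₀
              (fun t : ℕ => (conjKernel (u1LeapfrogHMCN ε κ hg (fun v => S (F v) - Real.log (J v)) n) F).comap
                (fun h : (i : ↥(Finset.Iic t)) → (ι → Circle) =>
                  h ⟨t, Finset.mem_Iic.2 le_rfl⟩) (measurable_pi_apply _)))]
    {Ω' : Type*} [MeasurableSpace Ω'] {P' : Measure Ω'} [IsProbabilityMeasure P'] {Y : Ω' → ℝ}
    (hY : HasLaw Y (gaussianReal 0 (Real.toNNReal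
      ((∫ y, (f y - ∫ z, f z ∂(u1GibbsLaw S)) ^ 2 ∂(u1GibbsLaw S))
              + 2 * ∑' k, ∫ y, (f y - ∫ z, f z ∂(u1GibbsLaw S))
                * (kop (conjKernel (u1LeapfrogHMCN ε κ hg (fun v => S (F v) - Real.log (J v)) n) F))^[k + 1]
                  (fun y => f y - ∫ z, f z ∂(u1GibbsLaw S)) y ∂(u1GibbsLaw S)))) P') :
    TendstoInDistribution (fun (N' : ℕ) (x : ℕ → (ι → Circle)) =>
        (Real.sqrt N')⁻¹ * ∑ t ∈ Finset.range N', (f (x t) - ∫ z, f z ∂(u1GibbsLaw S)))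
      atTop Y (fun _ => (Kernel.trajMeasure (X := fun _ : ℕ => ι → Circle) μ₀
              (fun t : ℕ => (conjKernel (u1LeapfrogHMCN ε κ hg (fun v => S (F v) - Real.log (J v)) n) F).comap
                (fun h : (i : ↥(Finset.Iic t)) → (ι → Circle) =>
                  h ⟨t, Finset.mem_Iic.2 le_rfl⟩) (measurable_pi_apply _)))) P' := by
  haveI := isProbabilityMeasure_u1GibbsLaw (ι := ι) hs
  obtain ⟨hinv, hν, ε', hε0, -, hmin⟩ := u1LeapfrogFTHMCN_certificate hε hκ hn hg hgK hshort hb0 hb hS hs hj₁ hJ₁ hJ₂ hJm hF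
  exact GeneralNCMC.tendstoInDistribution_timeAverage_of_nHit hinv hε0.ne' hmin Nat.one_pos hf hC μ₀ hY

/-- **BATCH MEANS ESTIMATE `σ²_f` CONSISTENTLY ALONG THE REPORTED `U(1)` FT-HMC, FROM EVERY INITIAL LAW.** -/
theorem u1LeapfrogFTHMCN_batchMeans_tendstoInMeasure (hε : 0 < ε) (hκ : 0 < κ) (hn : 1 ≤ n)
    (hg : Measurable g) (hgK : LipschitzWith K g) (hshort : 4 * (K : ℝ) * ε * (n : ℝ) ^ 2 ≤ 3)
    (hb0 : 0 ≤ b) (hb : ∀ u l, ‖g u l‖ ≤ b) (hS : Measurable S) (hs : ∀ u, |S u| ≤ s)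
    (hj₁ : 0 < j₁) (hJ₁ : ∀ v, j₁ ≤ J v) (hJ₂ : ∀ v, J v ≤ j₂) (hJm : Measurable J)
    (hF : HasJacobian (Measure.pi fun _ : ι => haarProbability Circle) F fun v => ENNReal.ofReal (J v))
    [IsMarkovKernel (u1LeapfrogHMCN ε κ hg (fun v => S (F v) - Real.log (J v)) n)]
    {f : (ι → Circle) → ℝ} (hf : Measurable f) {C : ℝ} (hC : ∀ U, |f U| ≤ C)
    (μ₀ : Measure (ι → Circle)) [IsProbabilityMeasure μ₀]
    {a b' : ℕ → ℕ} (ha : Tendsto a atTop atTop) (hb' : Tendsto b' atTop atTop) :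
    TendstoInMeasure (Kernel.trajMeasure (X := fun _ : ℕ => ι → Circle) μ₀
              (fun t : ℕ => (conjKernel (u1LeapfrogHMCN ε κ hg (fun v => S (F v) - Real.log (J v)) n) F).comap
                (fun h : (i : ↥(Finset.Iic t)) → (ι → Circle) =>
                  h ⟨t, Finset.mem_Iic.2 le_rfl⟩) (measurable_pi_apply _)))
      (fun (N' : ℕ) (x : ℕ → (ι → Circle)) => ((b' N' * a N' : ℕ) : ℝ)
        * replicaSEsq (fun j (x : ℕ → (ι → Circle)) =>
            (∑ i ∈ Finset.range (b' N'), f (x (b' N' * j + i))) / (b' N')) (a N') x)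
      atTop (fun _ => (∫ y, (f y - ∫ z, f z ∂(u1GibbsLaw S)) ^ 2 ∂(u1GibbsLaw S))
              + 2 * ∑' k, ∫ y, (f y - ∫ z, f z ∂(u1GibbsLaw S))
                * (kop (conjKernel (u1LeapfrogHMCN ε κ hg (fun v => S (F v) - Real.log (J v)) n) F))^[k + 1]
                  (fun y => f y - ∫ z, f z ∂(u1GibbsLaw S)) y ∂(u1GibbsLaw S)) := by
  haveI := isProbabilityMeasure_u1GibbsLaw (ι := ι) hs
  obtain ⟨hinv, hν, ε', hε0, hε1, hmin⟩ := u1LeapfrogFTHMCN_certificate hε hκ hn hg hgK hshort hb0 hb hS hs hj₁ hJ₁ hJ₂ hJm hF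
  exact Scoring.chain_batchMeans_sigmaHat_tendstoInMeasure_of_nHit hinv (GeneralNCMC.minorised_setwise hmin)
    hε0 hε1 Nat.one_pos hf hC μ₀ ha hb'

/-- **THE BATCH-MEANS INTERVAL OF A `U(1)` FT-HMC RUN IS ASYMPTOTICALLY EXACT** (`σ²_f > 0`, any initial law, `z > 0`). -/
theorem u1LeapfrogFTHMCN_batchMeans_coverage (hε : 0 < ε) (hκ : 0 < κ) (hn : 1 ≤ n)
    (hg : Measurable g) (hgK : LipschitzWith K g) (hshort : 4 * (K : ℝ) * ε * (n : ℝ) ^ 2 ≤ 3)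
    (hb0 : 0 ≤ b) (hb : ∀ u l, ‖g u l‖ ≤ b) (hS : Measurable S) (hs : ∀ u, |S u| ≤ s)
    (hj₁ : 0 < j₁) (hJ₁ : ∀ v, j₁ ≤ J v) (hJ₂ : ∀ v, J v ≤ j₂) (hJm : Measurable J)
    (hF : HasJacobian (Measure.pi fun _ : ι => haarProbability Circle) F fun v => ENNReal.ofReal (J v))
    [IsMarkovKernel (u1LeapfrogHMCN ε κ hg (fun v => S (F v) - Real.log (J v)) n)]
    {f : (ι → Circle) → ℝ} (hf : Measurable f) {C : ℝ} (hC : ∀ U, |f U| ≤ C)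
    (hσ : 0 < (∫ y, (f y - ∫ z, f z ∂(u1GibbsLaw S)) ^ 2 ∂(u1GibbsLaw S))
              + 2 * ∑' k, ∫ y, (f y - ∫ z, f z ∂(u1GibbsLaw S))
                * (kop (conjKernel (u1LeapfrogHMCN ε κ hg (fun v => S (F v) - Real.log (J v)) n) F))^[k + 1]
                  (fun y => f y - ∫ z, f z ∂(u1GibbsLaw S)) y ∂(u1GibbsLaw S))
    (μ₀ : Measure (ι → Circle)) [IsProbabilityMeasure μ₀]
    {a b' : ℕ → ℕ} (ha : Tendsto a atTop atTop) (hb' : Tendsto b' atTop atTop) {z : ℝ} (hz : 0 < z) :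
    Tendsto (fun N' : ℕ => (Kernel.trajMeasure (X := fun _ : ℕ => ι → Circle) μ₀
              (fun t : ℕ => (conjKernel (u1LeapfrogHMCN ε κ hg (fun v => S (F v) - Real.log (J v)) n) F).comap
                (fun h : (i : ↥(Finset.Iic t)) → (ι → Circle) =>
                  h ⟨t, Finset.mem_Iic.2 le_rfl⟩) (measurable_pi_apply _))).real
      {x | |((Real.sqrt ((b' N' * a N' : ℕ) : ℝ))⁻¹
          * ∑ t ∈ Finset.range (b' N' * a N'), (f (x t) - ∫ z, f z ∂(u1GibbsLaw S)))
        / Real.sqrt (((b' N' * a N' : ℕ) : ℝ)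
          * replicaSEsq (fun j (x : ℕ → (ι → Circle)) =>
              (∑ i ∈ Finset.range (b' N'), f (x (b' N' * j + i))) / (b' N')) (a N') x)| ≤ z})
      atTop (𝓝 ((gaussianReal 0 1).real (Set.Icc (-z) z))) := by
  haveI := isProbabilityMeasure_u1GibbsLaw (ι := ι) hs
  obtain ⟨hinv, hν, ε', hε0, hε1, hmin⟩ := u1LeapfrogFTHMCN_certificate hε hκ hn hg hgK hshort hb0 hb hS hs hj₁ hJ₁ hJ₂ hJm hF
  exact Scoring.doeblinPower_batchMeans_studentized_coverage hinv hmin hε0 hε1 Nat.one_pos hf hC hσ μ₀ ha hb' hz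

/-- **THE REPORTED `τ̂_int = σ̂²_BM/(2 v̂)` OF A `U(1)` FT-HMC RUN IS CONSISTENT** (`Var_π f ≠ 0`, any initial law). -/
theorem u1LeapfrogFTHMCN_tauInt_tendstoInMeasure (hε : 0 < ε) (hκ : 0 < κ) (hn : 1 ≤ n)
    (hg : Measurable g) (hgK : LipschitzWith K g) (hshort : 4 * (K : ℝ) * ε * (n : ℝ) ^ 2 ≤ 3)
    (hb0 : 0 ≤ b) (hb : ∀ u l, ‖g u l‖ ≤ b) (hS : Measurable S) (hs : ∀ u, |S u| ≤ s)
    (hj₁ : 0 < j₁) (hJ₁ : ∀ v, j₁ ≤ J v) (hJ₂ : ∀ v, J v ≤ j₂) (hJm : Measurable J)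
    (hF : HasJacobian (Measure.pi fun _ : ι => haarProbability Circle) F fun v => ENNReal.ofReal (J v))
    [IsMarkovKernel (u1LeapfrogHMCN ε κ hg (fun v => S (F v) - Real.log (J v)) n)]
    {f : (ι → Circle) → ℝ} (hf : Measurable f) {C : ℝ} (hC : ∀ U, |f U| ≤ C)
    (hvar : autocov (conjKernel (u1LeapfrogHMCN ε κ hg (fun v => S (F v) - Real.log (J v)) n) F)
        (u1GibbsLaw S) (fun y => f y - ∫ z, f z ∂(u1GibbsLaw S)) 0 ≠ 0)
    (μ₀ : Measure (ι → Circle)) [IsProbabilityMeasure μ₀]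
    {a b' : ℕ → ℕ} (ha : Tendsto a atTop atTop) (hb' : Tendsto b' atTop atTop) :
    TendstoInMeasure (Kernel.trajMeasure (X := fun _ : ℕ => ι → Circle) μ₀
              (fun t : ℕ => (conjKernel (u1LeapfrogHMCN ε κ hg (fun v => S (F v) - Real.log (J v)) n) F).comap
                (fun h : (i : ↥(Finset.Iic t)) → (ι → Circle) =>
                  h ⟨t, Finset.mem_Iic.2 le_rfl⟩) (measurable_pi_apply _)))
      (fun (N' : ℕ) (x : ℕ → (ι → Circle)) =>
        (((b' N' * a N' : ℕ) : ℝ)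
          * replicaSEsq (fun j (x : ℕ → (ι → Circle)) =>
              (∑ i ∈ Finset.range (b' N'), f (x (b' N' * j + i))) / (b' N')) (a N') x)
        / (2 * ((∑ t ∈ Finset.range (b' N' * a N'), f (x t) ^ 2) / ((b' N' * a N' : ℕ) : ℝ)
            - ((∑ t ∈ Finset.range (b' N' * a N'), f (x t)) / ((b' N' * a N' : ℕ) : ℝ)) ^ 2)))
      atTop (fun _ => tauInt (fun t =>
        autocov (conjKernel (u1LeapfrogHMCN ε κ hg (fun v => S (F v) - Real.log (J v)) n) F)
            (u1GibbsLaw S) (fun y => f y - ∫ z, f z ∂(u1GibbsLaw S)) t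
          / autocov (conjKernel (u1LeapfrogHMCN ε κ hg (fun v => S (F v) - Real.log (J v)) n) F)
            (u1GibbsLaw S) (fun y => f y - ∫ z, f z ∂(u1GibbsLaw S)) 0)) := by
  haveI := isProbabilityMeasure_u1GibbsLaw (ι := ι) hs
  obtain ⟨hinv, hν, ε', hε0, hε1, hmin⟩ := u1LeapfrogFTHMCN_certificate hε hκ hn hg hgK hshort hb0 hb hS hs hj₁ hJ₁ hJ₂ hJm hF
  exact Scoring.chain_batchMeans_tauInt_tendstoInMeasure_of_nHit hinv hmin hε0 hε1 Nat.one_pos hf hC hvar μ₀ ha hb'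

end FTHMC

end Summit.Ventures.LatticeQCDFlow.Exactness

end
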